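import Summits.HodgeConjecture.HodgeConjecture.Theorems.K2LiuDoublingHeightDecayOfNormIntegrable   -- ★ p855258 (K2Liu-p04): `doublingHeightDecay_of_adelicNormIntegrable` (#16b ⇒ this socket)
import Summits.HodgeConjecture.HodgeConjecture.Theorems.K2LiuAdelicNormIntegrable                -- ★ p855222 (K2Liu-p03): #16b `adelicNormIntegrable` BY NAME
import HarnessLib

/-!
# Crux `HLiu418`, Track B road `K2_Liu`, unit U5 «DOUBLING ZETA» — socket #16 `sig_K2LiuDoublingHeightDecay` PAID BY NAME (organ (IV) «HEIGHT DECAY» of row #14, assembly (IV-e))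

Cell `hodgecm-mathlib`, crux item hLiu418 = `stmt-HodgeConjecture-24832`, route of record `HCCMUnconditional`; squad K2 ∕ K2Liu, prover K2Liu-p04 (g0).
Socket #16 `sig_K2LiuDoublingHeightDecay` of `Cruxes/HLiu418/Lines/K2_Liu_CurveThetaSigs_U5_DoublingZeta.lean`, U5 ED. 6 (5cff0c75aa6afdae) :205–:217 — statement below
BYTE-IDENTICAL (block sha16 7f8479ef17577684); THEOREMS ONLY; lane `--supports stmt-HodgeConjecture-24832 --as helper`.

THE ARGUMENT.  (IV-e) = (IV-c) + (IV-d): ★ #16a `K2LiuDoublingHeightDecayPointwise.doublingHeightDecayPointwise` (`Φ(ι(g,1)) ≤ C ‖g‖^{-α}`,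
`N ≥ 1`) and ★ #16b `K2LiuAdelicNormIntegrable.adelicNormIntegrable` (Weil's criterion: `‖g‖^{-β}` integrable on `U(V)(𝔸)` for `β > β₀`) give, by
domination, the integrability of `Φ(ι(g,1))^τ` for `τ ≥ τ₁`; the junk corner `N = 0` (one-point group) is cased inside ★ p855258
`doublingHeightDecay_of_adelicNormIntegrable`, of which this file is the one-line application ([GelbartPiatetskishapiroRallis1987, Part A §2];
[Liu2021, Lem. B.10 (2) p. 102]; [BorelJacquet1979, §1.2, §4.2]).

HONEST LABEL.  `HC_CM` is proved only modulo the 7 printed citations (2 remaining named inputs: hLiu418 = `stmt-HodgeConjecture-24832`, h413 =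
`stmt-HodgeConjecture-24833`) until rung 0 closes; this file pays ONE tier-1 socket by name and retires nothing else.
-/

set_option autoImplicit false
-- the mandated namespace repeats the single-problem summit's segment (`HodgeConjecture.HodgeConjecture`)
set_option linter.dupNamespace false

noncomputable section

open scoped Matrix NNReal
open NumberField IsDedekindDomain MeasureTheory

namespace Summit.HodgeConjecture.HodgeConjecture.Cruxes.HLiu418.K2LiuDoublingHeightDecay

open Literature.NumberTheory.Automorphic Literature.NumberTheory.Automorphic.UnitaryGroup
open Literature.NumberTheory.GelbartRogawski1991 Literature.NumberTheory.GelbartRogawski1991.GRConstruction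
open Literature.NumberTheory.K2Lit.SiegelDoubled
open Literature.NumberTheory.GaloisRepresentations (HeckeCharacter)
open Summit.HodgeConjecture.HodgeConjecture.Cruxes.HLiu418.K2LiuDoublingHeightDecayOfNormIntegrable
open Summit.HodgeConjecture.HodgeConjecture.Cruxes.HLiu418.K2LiuAdelicNormIntegrable

/-- **PAYMENT OF `sig_K2LiuDoublingHeightDecay`** (socket #16 of unit U5 «DOUBLING ZETA», ED. 6 :205, TOKEN FOR TOKEN).  **THE `P_Δ`-HEIGHT DECAYS
INTEGRABLY ALONG THE DOUBLING EMBEDDING**: for non-degenerate hermitian data over a CM field and every continuous positive `Φ : H(𝔸) → ℝ` of type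
`(P_Δ, |det_Δ|^{1∕2})` there is `τ₁` such that `g ↦ Φ(ι(g,1))^τ` is `ν`-integrable on `U(V)(𝔸)` for every `τ ≥ τ₁` and every Haar measure `ν`
(★ #16a + ★ #16b via ★ `doublingHeightDecay_of_adelicNormIntegrable`). [cite: GelbartPiatetskishapiroRallis1987, Part A §2]
[cite: Liu2021, Lem. B.10 (2) p. 102] [cite: BorelJacquet1979, §1.2 and §4.2] -/
theorem doublingHeightDecay :
    ∀ (L : Type) [Field L] [NumberField L] [IsCMField L] {N n : ℕ} (e : Fin N × Fin 1 ≃ Fin n)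
      (dV : Fin N → L) (hdV : ∀ i, IsCMField.complexConj L (dV i) = dV i) (_hdV0 : ∀ i, dV i ≠ 0)
      (dW : Fin 1 → L) (hdW : ∀ i, IsCMField.complexConj L (dW i) = dW i) (_hdW0 : ∀ i, dW i ≠ 0)
      (Φ : HA L e dV hdV dW hdW → ℝ), Continuous Φ → (∀ x, 0 < Φ x) →
      (∀ p x : HA L e dV hdV dW hdW, IsSiegelDelta L e dV hdV dW hdW p →
        Φ (p * x) = modDelta L e dV hdV dW hdW p * Φ x) →
      ∃ τ₁ : ℝ, ∀ τ : ℝ, τ₁ ≤ τ →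
        ∀ [MeasurableSpace (UnitaryGroup.adelic (Fp L) L (IsCMField.complexConj L) N (Matrix.diagonal dV))]
          [BorelSpace (UnitaryGroup.adelic (Fp L) L (IsCMField.complexConj L) N (Matrix.diagonal dV))]
          (ν : Measure (UnitaryGroup.adelic (Fp L) L (IsCMField.complexConj L) N (Matrix.diagonal dV)))
          [ν.IsHaarMeasure],
          Integrable (fun g => Φ (iotaLeft L e dV hdV dW hdW g) ^ τ) ν :=
  doublingHeightDecay_of_adelicNormIntegrable adelicNormIntegrable

end Summit.HodgeConjecture.HodgeConjecture.Cruxes.HLiu418.K2LiuDoublingHeightDecay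

end
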